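import Literature.Topology.PlanarFoliations.Renorm
import Literature.Topology.FourManifolds.TautFoliations
import HarnessLib

/-!
# A foliation from a family of plane-valued charts with monotone height transitions

Topic: Topology / PlanarFoliations (chart bookkeeping). Let `X` be a topological space and
`𝒞` a family of open partial homeomorphisms `X → ℝ × ℝ` (with arbitrary open targets) whose
sources cover `X` and whose **height transitions are locally increasing**: near every point of
an overlap `c.source ∩ c'.source`, `(c y).2 < (c z).2 → (c' y).2 < (c' z).2`. Renormalising
every chart onto the whole plane around each point (`renormBox`, `Renorm.lean`) yields a
**foliated atlas**:

* `PreAtlas X` (**definition**): the data `(charts, cover, mono)`;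
* `PreAtlas.toFoliation` (**definition**, all axioms **proved**): the foliation `Foliation ℝ X`
  whose flow boxes are the renormalised charts `renormBox c p r` (`c ∈ charts`,
  `box p r ⊆ c.target`);
* `PreAtlas.isTransverselyOriented_toFoliation` (**proved**): it is transversely oriented;
* `PreAtlas.renormBox_mem_atlas`, `PreAtlas.exists_mem_atlas_of_mem_source` (**proved**):
  every point of `c.source` lies in a flow box `renormBox c (c x) r` of the atlas, whose
  heights induce the same equality/order relations as the heights of `c`.

Use: the contour charts of a disc in checkerboard cone position (sector charts, roof–floor
edge charts) all read, near each point, increasing functions of one local height, so they form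
a `PreAtlas`; `toFoliation` is the induced singular foliation off its singular points. All
statements are [folklore].
-/

noncomputable section

open Set Filter Topology
open Literature.Topology.FourManifolds

namespace Literature.Topology.PlanarFoliations

variable {X : Type*} [TopologicalSpace X]

/-- **A pre-atlas of plane-valued charts with locally increasing height transitions.**
[folklore] -/
structure PreAtlas (X : Type*) [TopologicalSpace X] where
  /-- the charts [folklore] -/
  charts : Set (OpenPartialHomeomorph X (ℝ × ℝ))
  /-- the sources cover [folklore] -/
  cover : ∀ x : X, ∃ c ∈ charts, x ∈ c.source
  /-- height transitions are locally increasing [folklore] -/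
  mono : ∀ c ∈ charts, ∀ c' ∈ charts, ∀ x ∈ c.source ∩ c'.source, ∃ U ∈ 𝓝 x,
    ∀ y ∈ U ∩ (c.source ∩ c'.source), ∀ z ∈ U ∩ (c.source ∩ c'.source), (c y).2 < (c z).2 → (c' y).2 < (c' z).2

namespace PreAtlas

variable (A : PreAtlas X)

/-- The flow boxes: renormalisations of the charts onto the whole plane. [folklore] -/
def boxes : Set (OpenPartialHomeomorph X (ℝ × ℝ)) :=
  {e | ∃ c ∈ A.charts, ∃ (p : ℝ × ℝ) (r : ℝ) (hr : 0 < r), box p r ⊆ c.target ∧ e = renormBox c p r hr}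

/-- A renormalised chart is a flow box. [folklore] -/
theorem renormBox_mem_boxes {c : OpenPartialHomeomorph X (ℝ × ℝ)} (hc : c ∈ A.charts) {p : ℝ × ℝ} {r : ℝ}
    (hr : 0 < r) (hbox : box p r ⊆ c.target) : renormBox c p r hr ∈ A.boxes :=
  ⟨c, hc, p, r, hr, hbox, rfl⟩

/-- **Symmetrised monotonicity gives local equality of height relations.** [folklore] -/
theorem exists_nhds_lt_iff {c c' : OpenPartialHomeomorph X (ℝ × ℝ)} (hc : c ∈ A.charts) (hc' : c' ∈ A.charts) {x : X}
    (hx : x ∈ c.source ∩ c'.source) :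
    ∃ U ∈ 𝓝 x, ∀ y ∈ U ∩ (c.source ∩ c'.source), ∀ z ∈ U ∩ (c.source ∩ c'.source),
      ((c y).2 < (c z).2 ↔ (c' y).2 < (c' z).2) ∧ ((c y).2 = (c z).2 ↔ (c' y).2 = (c' z).2) := by
  obtain ⟨U₁, hU₁, h₁⟩ := A.mono c hc c' hc' x hx
  obtain ⟨U₂, hU₂, h₂⟩ := A.mono c' hc' c hc x ⟨hx.2, hx.1⟩
  refine ⟨U₁ ∩ U₂, inter_mem hU₁ hU₂, fun y hy z hz ↦ ?_⟩
  have hy₁ : y ∈ U₁ ∩ (c.source ∩ c'.source) := ⟨hy.1.1, hy.2⟩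
  have hz₁ : z ∈ U₁ ∩ (c.source ∩ c'.source) := ⟨hz.1.1, hz.2⟩
  have hy₂ : y ∈ U₂ ∩ (c'.source ∩ c.source) := ⟨hy.1.2, hy.2.2, hy.2.1⟩
  have hz₂ : z ∈ U₂ ∩ (c'.source ∩ c.source) := ⟨hz.1.2, hz.2.2, hz.2.1⟩
  have hlt : (c y).2 < (c z).2 ↔ (c' y).2 < (c' z).2 := ⟨h₁ y hy₁ z hz₁, h₂ y hy₂ z hz₂⟩
  have hgt : (c z).2 < (c y).2 ↔ (c' z).2 < (c' y).2 := ⟨h₁ z hz₁ y hy₁, h₂ z hz₂ y hy₂⟩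
  refine ⟨hlt, ⟨fun h ↦ ?_, fun h ↦ ?_⟩⟩
  · rcases lt_trichotomy (c' y).2 (c' z).2 with h' | h' | h'
    · exact absurd (hlt.2 h') (by rw [h]; exact lt_irrefl _)
    · exact h'
    · exact absurd (hgt.2 h') (by rw [h]; exact lt_irrefl _)
  · rcases lt_trichotomy (c y).2 (c z).2 with h' | h' | h'
    · exact absurd (hlt.1 h') (by rw [h]; exact lt_irrefl _)
    · exact h'
    · exact absurd (hgt.1 h') (by rw [h]; exact lt_irrefl _)

/-- **The foliation defined by a pre-atlas.** [folklore] -/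
def toFoliation : Foliation ℝ X where
  atlas := A.boxes
  target_eq := by
    rintro e ⟨c, -, p, r, hr, hbox, rfl⟩
    exact renormBox_target hbox
  exists_mem_source x := by
    obtain ⟨c, hc, hx⟩ := A.cover x
    obtain ⟨r, hr, hbox⟩ := exists_box_subset_target hx
    exact ⟨renormBox c (c x) r hr, A.renormBox_mem_boxes hc hr hbox, mem_renormBox_source_self hx hr⟩
  locally_plaque := by
    rintro e ⟨c, hc, p, r, hr, -, rfl⟩ e' ⟨c', hc', p', r', hr', -, rfl⟩ x ⟨hx, hx'⟩
    obtain ⟨U, hU, hiff⟩ := A.exists_nhds_lt_iff hc hc' ⟨renormBox_source_subset _ _ _ _ hx, renormBox_source_subset _ _ _ _ hx'⟩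
    refine ⟨U, hU, fun y hy z hz h ↦ ?_⟩
    have hyc : y ∈ U ∩ (c.source ∩ c'.source) :=
      ⟨hy.1, renormBox_source_subset _ _ _ _ hy.2.1, renormBox_source_subset _ _ _ _ hy.2.2⟩
    have hzc : z ∈ U ∩ (c.source ∩ c'.source) :=
      ⟨hz.1, renormBox_source_subset _ _ _ _ hz.2.1, renormBox_source_subset _ _ _ _ hz.2.2⟩
    rw [renormBox_snd_eq_iff hy.2.2 hz.2.2]
    rw [renormBox_snd_eq_iff hy.2.1 hz.2.1] at h
    exact ((hiff y hyc z hzc).2).1 h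

/-- The atlas of the foliation of a pre-atlas. [folklore] -/
theorem toFoliation_atlas : A.toFoliation.atlas = A.boxes := rfl

/-- **The foliation of a pre-atlas is transversely oriented.** [folklore] -/
theorem isTransverselyOriented_toFoliation : A.toFoliation.IsTransverselyOriented := by
  rintro e ⟨c, hc, p, r, hr, -, rfl⟩ e' ⟨c', hc', p', r', hr', -, rfl⟩ x ⟨hx, hx'⟩
  obtain ⟨U, hU, hiff⟩ := A.exists_nhds_lt_iff hc hc' ⟨renormBox_source_subset _ _ _ _ hx, renormBox_source_subset _ _ _ _ hx'⟩
  refine ⟨U, hU, fun y hy z hz h ↦ ?_⟩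
  have hyc : y ∈ U ∩ (c.source ∩ c'.source) :=
    ⟨hy.1, renormBox_source_subset _ _ _ _ hy.2.1, renormBox_source_subset _ _ _ _ hy.2.2⟩
  have hzc : z ∈ U ∩ (c.source ∩ c'.source) :=
    ⟨hz.1, renormBox_source_subset _ _ _ _ hz.2.1, renormBox_source_subset _ _ _ _ hz.2.2⟩
  rw [renormBox_snd_lt_iff hy.2.2 hz.2.2]
  rw [renormBox_snd_lt_iff hy.2.1 hz.2.1] at h
  exact ((hiff y hyc z hzc).1).1 h

/-- **Every point of a chart source lies in a flow box renormalising that chart at the point.**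
[folklore] -/
theorem exists_mem_atlas_of_mem_source {c : OpenPartialHomeomorph X (ℝ × ℝ)} (hc : c ∈ A.charts) {x : X}
    (hx : x ∈ c.source) :
    ∃ (r : ℝ) (hr : 0 < r), renormBox c (c x) r hr ∈ A.toFoliation.atlas ∧ x ∈ (renormBox c (c x) r hr).source := by
  obtain ⟨r, hr, hbox⟩ := exists_box_subset_target hx
  exact ⟨r, hr, A.renormBox_mem_boxes hc hr hbox, mem_renormBox_source_self hx hr⟩

/-- **Plaques of the flow boxes are level sets of the chart heights**: two points of the source
of `renormBox c p r` lie at the same height iff their `c`-heights agree. [folklore] -/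
theorem snd_eq_iff_of_mem {c : OpenPartialHomeomorph X (ℝ × ℝ)} {p : ℝ × ℝ} {r : ℝ} {hr : 0 < r} {y z : X}
    (hy : y ∈ (renormBox c p r hr).source) (hz : z ∈ (renormBox c p r hr).source) :
    (renormBox c p r hr y).2 = (renormBox c p r hr z).2 ↔ (c y).2 = (c z).2 :=
  renormBox_snd_eq_iff hy hz

/-- **Points of a chart source at equal chart height, close together, lie on a common plaque**
of the foliation (hence in the same leaf). [folklore] -/
theorem samePlaque_of_snd_eq {c : OpenPartialHomeomorph X (ℝ × ℝ)} (hc : c ∈ A.charts) {p : ℝ × ℝ} {r : ℝ}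
    {hr : 0 < r} (hbox : box p r ⊆ c.target) {y z : X} (hy : y ∈ (renormBox c p r hr).source)
    (hz : z ∈ (renormBox c p r hr).source) (h : (c y).2 = (c z).2) : A.toFoliation.SamePlaque y z :=
  ⟨renormBox c p r hr, A.renormBox_mem_boxes hc hr hbox, hy, hz, (renormBox_snd_eq_iff hy hz).2 h⟩

end PreAtlas

end Literature.Topology.PlanarFoliations
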